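import Summits.CriticalPhenomena.PercolationContinuityZ3.Theorems.PercNearOneGluingNoHeavyLowerTailSahiCombUnique
import Summits.CriticalPhenomena.PercolationContinuityZ3.Theorems.PercNearOneGluingNoHeavyLowerTailSahiRecursionCert

/-!
# The comb (tensor-Bernstein) hierarchy for Sahi's `E_k`, X: BRIDGE to the `n`-copy certificate algebra — prim-l12 P5's COMPUTABLE
# coefficient vectors `NCopyCert.sahiCoef` ARE the uniform comb coefficients `SahiComb.combCoeff`, for every order `n` and every cube `Fin m`

Support file of the one-cut programme (crux `NoHeavyLowerTail`, stmt-CriticalPhenomena-4575; cell `prim-masterthm`, seat P5).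
`SahiComb.combCoeff n f j` (`…SahiCombCopyKernel`) is a noncomputable real fibre sum of the `n`-copy kernel over `(2^ι)^n`;
`NCopyCert.sahiCoef m n a` (`…SahiRecursionCert`, prim-l12 P5 gen 5) is an INTEGER coefficient vector computed by running the Lieb–Sahi
recursion on bitmask tables, with `NCopyCert.evB_sahiCoef`: `evB n (sahiCoef m n (encA ∘ A)) p = E_n(μ_p; 1_A)`.  Both are degree-`n`
tensor-Bernstein expansions of the same function, so by uniqueness (`SahiComb.bern_coeff_unique`):

* `SahiComb.keyProfN` / `profKeyN` — keys `Fin m → Fin (n+1)` ↔ profiles in `box n` (the `n`-general form of `SahiC4CombBridge.keyProf`);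
* `SahiComb.evB_eq_sum_box` — `evB` in the `box`/`bern` vocabulary;
* **`SahiComb.sahiCoef_eq_combCoeff`** — `(sahiCoef m n (encA ∘ A) K : ℝ) = combCoeff n (1_A) (keyProfN K)` for every family of events
  `A : Fin n → Set (Set (Fin m))`, every `n`, `m`; and **`SahiComb.combCoeff_eq_sahiCoef`** — conversely on the box: the uniform comb
  coefficients of event families on a cube ARE integers computed by `sahiCoef` (a computable mirror for kernel checks of the typed shape
  laws of `…SahiCombShape`, any order), `combCoeff_ind_fin_isInt`.
Everything here is proved; axioms standard. [this work]
-/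

noncomputable section

open scoped Classical

namespace Summit.CriticalPhenomena.PercolationContinuityZ3.Theorems

open Finset Function
open Literature.Combinatorics.Sahi2008
open Literature.Probability.Percolation.DecisionTree (ind)
open SahiComb SahiC3Cube NCopyCert

namespace SahiComb

variable {m n : ℕ}

/-- A key as a profile. [this work] -/
def keyProfN (K : Fin m → Fin (n + 1)) : Fin m → ℕ := fun i => (K i : ℕ)

/-- A profile as a key (truncated at `n`). [this work] -/
def profKeyN (n : ℕ) (j : Fin m → ℕ) : Fin m → Fin (n + 1) := fun i => ⟨min (j i) n, by omega⟩

/-- Keys lie in the box. [this work] -/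
theorem keyProfN_mem_box (K : Fin m → Fin (n + 1)) : keyProfN K ∈ box (fun _ : Fin m => n) :=
  mem_box.2 fun i => by have := (K i).2; simp only [keyProfN]; omega

/-- `profKeyN ∘ keyProfN = id`. [this work] -/
theorem profKeyN_keyProfN (K : Fin m → Fin (n + 1)) : profKeyN n (keyProfN K) = K := by
  funext i; apply Fin.ext; have := (K i).2; simp only [profKeyN, keyProfN]; omega

/-- `keyProfN ∘ profKeyN = id` on the box. [this work] -/
theorem keyProfN_profKeyN {j : Fin m → ℕ} (hj : j ∈ box (fun _ : Fin m => n)) : keyProfN (profKeyN n j) = j := by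
  funext i; have := mem_box.1 hj i; simp only [profKeyN, keyProfN]; omega

/-- The two degree-`n` bases agree: `∏_i bernW n (p_i) (K_i) = bern n (keyProfN K) p`. [this work] -/
theorem prod_bernW_eq_bern (p : Fin m → unitInterval) (K : Fin m → Fin (n + 1)) :
    ∏ i, bernW n (p i : ℝ) (K i) = bern (fun _ : Fin m => n) (keyProfN K) p := rfl

/-- `evB` re-indexed over the box of profiles. [this work] -/
theorem evB_eq_sum_box (c : (Fin m → Fin (n + 1)) → ℤ) (p : Fin m → unitInterval) :
    evB n c (fun i => (p i : ℝ)) = ∑ j ∈ box (fun _ : Fin m => n), (c (profKeyN n j) : ℝ) * bern (fun _ : Fin m => n) j p := by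
  unfold evB
  refine sum_nbij' keyProfN (profKeyN n) (fun K _ => keyProfN_mem_box K) (fun j _ => mem_univ _)
    (fun K _ => profKeyN_keyProfN K) (fun j hj => keyProfN_profKeyN hj) (fun K _ => ?_)
  rw [profKeyN_keyProfN, prod_bernW_eq_bern]

/-- **prim-l12 P5's computable coefficient vector IS the uniform comb coefficient family**: for every family of events of the cube
`Fin m` and every key, `sahiCoef m n (encA ∘ A) K = combCoeff n (1_A) (keyProfN K)`. [this work] -/
theorem sahiCoef_eq_combCoeff (A : Fin n → Set (Set (Fin m))) (K : Fin m → Fin (n + 1)) :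
    (sahiCoef m n (fun i => encA m (A i)) K : ℝ) = combCoeff n (fun i => ind (A i)) (keyProfN K) := by
  have h := bern_coeff_unique (c := fun _ : Fin m => n)
    (N := fun j => (sahiCoef m n (fun i => encA m (A i)) (profKeyN n j) : ℝ)) (M := combCoeff n (fun i => ind (A i)))
    (fun p => by rw [← evB_eq_sum_box, evB_sahiCoef, sahiE_bernoulliWeight_eq_sum_combCoeff]) (keyProfN K) (keyProfN_mem_box K)
  rwa [profKeyN_keyProfN] at h

/-- **Conversely, on the box the uniform comb coefficients of an event family on a cube are the integers `sahiCoef`.** [this work] -/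
theorem combCoeff_eq_sahiCoef (A : Fin n → Set (Set (Fin m))) {j : Fin m → ℕ} (hj : j ∈ box (fun _ : Fin m => n)) :
    combCoeff n (fun i => ind (A i)) j = (sahiCoef m n (fun i => encA m (A i)) (profKeyN n j) : ℝ) := by
  rw [sahiCoef_eq_combCoeff, keyProfN_profKeyN hj]

/-- The comb coefficients of an event family on a cube are integers (zero off the box). [this work] -/
theorem combCoeff_ind_fin_isInt (A : Fin n → Set (Set (Fin m))) (j : Fin m → ℕ) :
    ∃ z : ℤ, combCoeff n (fun i => ind (A i)) j = z := by
  by_cases hj : j ∈ box (fun _ : Fin m => n)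
  · exact ⟨_, combCoeff_eq_sahiCoef A hj⟩
  · exact ⟨0, by rw [combCoeff_eq_zero_of_not_mem_box _ hj, Int.cast_zero]⟩

/-- **Coefficientwise nonnegativity from the computable vector**: if every entry of `sahiCoef m n (encA ∘ A)` is `≥ 0` then every
uniform comb coefficient of `A` is `≥ 0` (and conversely). [this work] -/
theorem combCoeff_ind_nonneg_iff_sahiCoef_nonneg (A : Fin n → Set (Set (Fin m))) :
    (∀ j, 0 ≤ combCoeff n (fun i => ind (A i)) j) ↔ ∀ K, 0 ≤ sahiCoef m n (fun i => encA m (A i)) K := by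
  constructor
  · intro h K
    have h1 := h (keyProfN K)
    rw [← sahiCoef_eq_combCoeff] at h1
    exact_mod_cast h1
  · intro h j
    by_cases hj : j ∈ box (fun _ : Fin m => n)
    · rw [combCoeff_eq_sahiCoef A hj]; exact_mod_cast h _
    · exact (combCoeff_eq_zero_of_not_mem_box _ hj).ge

end SahiComb

end Summit.CriticalPhenomena.PercolationContinuityZ3.Theorems
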